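import Mathlib.AlgebraicGeometry.EllipticCurve.Reduction
import Literature.NumberTheory.EllipticCurves.BSDRootNumberSmallConductorProofs
import Literature.NumberTheory.EllipticCurves.GrossZagierRationalPoint
import Literature.NumberTheory.EllipticCurves.Rank1Residual.Predicates
import HarnessLib

/-!
# Rank-≤1 residual class X11, clause `p = 3`: the set `mult(3) ∧ irr(3) ∧ r_an = 1`

HONEST FRAMING (cell `b2b-bsdres`, verbatim): the goal of the cell is to DELETE the COMBINATION-SHAPED
residual classes for ALL analytic-rank ≤ 1 elliptic curves over ℚ — "full BSD formula for every rank ≤ 1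
curve in class C" assembled STRICTLY from published theorems — so that the rank-≤1 remainder becomes
exactly the CONSTRUCTION-SHAPED classes, which are TYPED (missing-input Props), NOT attempted. This is
not "finishing BSD".

This file is the kernel-checked part of the audit `X11B-AUDIT.md` (cell HOME
`run/shared/lean/b2b/bsd-rank1-residual/b2b-bsdres-x11b/`) of the `p = 3` clause of the residual class
X11 of the census file `RESIDUAL-CASES.md` §a.2: the pairs `(E, 3)` with `3 ‖ N_E` (multiplicative
reduction at `3`), `E[3]` irreducible and `ord_{s=1} L(E,s) = 1`. It contains NO class theorem, because
none can be assembled from published theorems: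

* the only printed rank-one `p`-part theorem admitting `p = 3`, Jetchev–Skinner–Wan, Camb. J. Math. 5
  (2017), Thm. 1.2.1, is stated for "`p ≥ 3` a prime of good reduction (i.e., `p ∤ N`)" — false for every
  member of the class (`IsX11Three.not_hasGoodReductionAtPrime` below); its §7.4, remark (v), says the
  multiplicative case is not treated there;
* Skinner, Pacific J. Math. 283 (2016), Thm. C allows `p ≥ 3` and multiplicative `p` but is a rank-zero
  statement (`L(E,1) ≠ 0`) — false on the class (`IsX11Three.entireLFunction_one_eq_zero`);
* Castella, Camb. J. Math. 6 (2018), Thm. A and the author's Erratum, Thm. A′, assume `p > 3` (and the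
  printed proof of Thm. A for `p ‖ N` is withdrawn by that erratum); Skinner–Zhang, arXiv:1407.1099,
  Thm. 1.2 assumes `p ≥ 5` and is unpublished.

What IS a theorem in print for this set is the finite sub-class `N_E < 5000` (Miller, LMS J. Comput.
Math. 14 (2011), Thm. 1.2, with Lawson–Wuthrich 2016, §5), vendored in the tree as the named fact
`Literature.NumberTheory.EllipticCurves.bsdp_of_irreducible_of_conductor_lt`; it is recorded here as the
sub-class statement `IsX11Three.bsdp_three_of_conductor_lt` in the cell's currency `BSDp W 3`
(Miller's `BSD(E,3)`).

Deliberately NOT here: any `def … : Prop` for the missing input at `p = 3` (a construction-shaped gap —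
big Heegner points need `p ∤ 6N`, Howard, Invent. Math. 167 (2007), Hyp. 1.0.1; the two-variable
anticyclotomic `p`-adic `L`-function needs `p ≥ 5`, Castella, J. Inst. Math. Jussieu 19 (2020), §1 — see
the audit); the cell's literature seat owns the typed missing-input files.
-/

namespace Literature.NumberTheory.EllipticCurves.Rank1Residual

open WeierstrassCurve Literature.NumberTheory.EllipticCurves

variable (W : WeierstrassCurve ℚ)

/-- The `p = 3` clause of the residual class X11 of `RESIDUAL-CASES.md` §a.2 (predicates of §a.0:
`mult(3) ∧ irr(3) ∧ r = 1`), as a hypothesis structure on a Weierstrass model `W` of `E/ℚ`: `E` has multiplicative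
reduction at `3` (`W.HasMultiplicativeReductionAtPrime 3`, i.e. `3 ‖ N_E`), the mod-`3` representation
`E[3]` is irreducible (`W.HasIrreducibleModPGaloisRep 3`), and `ord_{s=1} L(E,s) = 1`
(`W.analyticRank = 1`). A conjunction of standard tree predicates; the name is this cell's bookkeeping
only. [folklore] -/
structure IsX11Three : Prop where
  /-- `3 ‖ N_E`: multiplicative reduction at `3`. -/
  mult : W.HasMultiplicativeReductionAtPrime 3
  /-- `E[3]` is an irreducible `G_ℚ`-module. -/
  irr : W.HasIrreducibleModPGaloisRep 3
  /-- `ord_{s=1} L(E,s) = 1`. -/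
  rank : W.analyticRank = 1

variable {W}

/-- Multiplicative reduction at `p` excludes good reduction at `p` (for the `ℤ_p`-minimal model of
`W/ℚ_p`; Silverman, *AEC*, VII.5, Prop. 5.1; Mathlib's
`WeierstrassCurve.HasMultiplicativeReduction.not_hasGoodReduction`). [folklore] -/
theorem not_hasGoodReductionAtPrime_of_hasMultiplicativeReductionAtPrime (p : ℕ) [Fact p.Prime]
    (h : W.HasMultiplicativeReductionAtPrime p) : ¬ W.HasGoodReductionAtPrime p :=
  WeierstrassCurve.HasMultiplicativeReduction.not_hasGoodReduction (R := ℤ_[p]) h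

/-- On the class, the hypothesis "`p` a prime of good reduction (i.e., `p ∤ N`)" of Jetchev–Skinner–Wan,
Camb. J. Math. 5 (2017), Thm. 1.2.1 FAILS at `p = 3`: a curve with multiplicative reduction at `3` does
not have good reduction at `3`. (Audit use: the class predicate does not imply — it contradicts — the
printed hypotheses of the only published rank-one `p`-part theorem that admits `p = 3`.) [folklore] -/
theorem IsX11Three.not_hasGoodReductionAtPrime (h : IsX11Three W) :
    ¬ W.HasGoodReductionAtPrime 3 :=
  not_hasGoodReductionAtPrime_of_hasMultiplicativeReductionAtPrime 3 h.mult

/-- On the class, the hypothesis "`L(E,1) ≠ 0`" of Skinner, Pacific J. Math. 283 (2016), Thm. C FAILS: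
`ord_{s=1} L(E,s) = 1` forces `L(E,1) = 0` (tree lemma
`entireLFunction_one_eq_zero_of_analyticRank_eq_one`). [folklore] -/
theorem IsX11Three.entireLFunction_one_eq_zero (h : IsX11Three W) : W.entireLFunction 1 = 0 :=
  entireLFunction_one_eq_zero_of_analyticRank_eq_one h.rank

/-- On the class, the prime thresholds of Castella, Camb. J. Math. 6 (2018), Thm. A / Erratum Thm. A′
("`p > 3`") and of Skinner–Zhang, arXiv:1407.1099, Thm. 1.2 ("`p ≥ 5`") FAIL at `p = 3` (arithmetic).
[folklore] -/
theorem three_not_above_castella_or_skinnerZhang_threshold : ¬ (3 < 3) ∧ ¬ (5 ≤ 3) := by decide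

/-- **The finite sub-class in print.** For `E/ℚ` in the class (given by a globally minimal model `W`)
with conductor `N_E < 5000`, `BSD(E,3)` holds — by Miller, LMS J. Comput. Math. 14 (2011), Thm. 1.2
(with Lawson–Wuthrich, Springer PROMS 188 (2016), §5), a computer-assisted theorem in print for ALL
`E/ℚ` with `ord_{s=1} L(E,s) ≤ 1`, `N_E < 5000` and irreducible `E[p]`, taken here as the tree's named
fact `bsdp_of_irreducible_of_conductor_lt`. This closes the SUB-class `IsX11Three ∧ N_E < 5000` only
(72 of the 111 census pairs with `N < 10⁴`); it is not a class theorem.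
[cite: Miller2011LMS, Thm. 1.2] [cite: LawsonWuthrich2016, §5, Thm. 14 and Prop. 15] -/
theorem IsX11Three.bsdp_three_of_conductor_lt (hM : bsdp_of_irreducible_of_conductor_lt)
    [W.IsElliptic] [W.IsGloballyMinimal] (h : IsX11Three W) (hN : W.conductorNorm ℤ < 5000) :
    BSDp W 3 :=
  hM W (le_of_eq h.rank) hN 3 Nat.prime_three h.irr

/-! ### Reconciliation with the cell's class predicates (`Rank1Residual/Predicates.lean`, p177443)

`ClassX11 W p` there is the full X11 predicate
`Mult W p ∧ Irr W p ∧ (¬ Ram W p ∨ (r = 1 ∧ ¬ Semistable W) ∨ (r = 1 ∧ p = 3))`; at `p = 3` with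
`r = 1` the third disjunct is automatic, so `IsX11Three W` is literally `ClassX11 W 3 ∧ r = 1`, and the
printed finite sub-class takes the cell's canonical shape
`analyticRank ≤ 1 → ClassX11 W 3 → (N < 5000) → BSDp W 3` (both ranks: Miller's theorem needs only
`irr(3)` and `r_an ≤ 1`). -/

/-- `IsX11Three W ↔ ClassX11 W 3 ∧ ord_{s=1} L(E,s) = 1`: the `p = 3`, `r = 1` clause of the census
class X11 in the two bookkeeping forms (RESIDUAL-CASES.md §a.2; bsdN/HYPOTHESES.md §Predicates).
[folklore] -/
theorem isX11Three_iff_classX11 (W : WeierstrassCurve ℚ) [W.IsGloballyMinimal] :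
    IsX11Three W ↔ ClassX11 W 3 ∧ W.analyticRank = 1 :=
  ⟨fun h => ⟨⟨h.mult, h.irr, Or.inr (Or.inr ⟨h.rank, rfl⟩)⟩, h.rank⟩,
    fun h => ⟨h.1.1, h.1.2.1, h.2⟩⟩

/-- **The printed finite sub-class in the cell's canonical shape (both ranks).** For `E/ℚ` (globally
minimal `W`) with `ord_{s=1} L(E,s) ≤ 1`, in class X11 at `p = 3` (`ClassX11 W 3`: multiplicative
reduction at `3`, `E[3]` irreducible, and `¬ram(3) ∨ r = 1`) and with `N_E < 5000`, `BSD(E,3)` holds —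
Miller, LMS J. Comput. Math. 14 (2011), Thm. 1.2 with Lawson–Wuthrich 2016, §5 (named fact
`bsdp_of_irreducible_of_conductor_lt`; only `irr(3)` and `r_an ≤ 1` are used). A SUB-class statement
(conductor bound), not a class theorem. [cite: Miller2011LMS, Thm. 1.2]
[cite: LawsonWuthrich2016, §5, Thm. 14 and Prop. 15] -/
theorem bsdp_three_of_classX11_of_conductor_lt (hM : bsdp_of_irreducible_of_conductor_lt)
    (W : WeierstrassCurve ℚ) [W.IsElliptic] [W.IsGloballyMinimal] (hr : W.analyticRank ≤ 1)
    (hC : ClassX11 W 3) (hN : W.conductorNorm ℤ < 5000) : BSDp W 3 :=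
  hM W hr hN 3 Nat.prime_three hC.2.1

end Literature.NumberTheory.EllipticCurves.Rank1Residual
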